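import Literature.AlgebraicGeometry.Resolution.KummerPthPowerElimination
import Literature.AlgebraicGeometry.Resolution.EventualDominance
import Literature.AlgebraicGeometry.Resolution.Kuhlmann2019Lemma41
import Literature.AlgebraicGeometry.Resolution.Kuhlmann2019Lemma47
import Literature.AlgebraicGeometry.Resolution.HenselizationHenselian
import Literature.AlgebraicGeometry.Resolution.KummerOneUnitsVT
import Mathlib.FieldTheory.IsSepClosed
import HarnessLib

/-!
# Kuhlmann 2019, Lemma 4.3 (mixed characteristic normal form): the Kaplansky centre and the first case

Topic: `Literature/AlgebraicGeometry/Resolution` (valued function fields). Part of the proof of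
the hypothesis `(H43)` of `Kuhlmann2019_Prop52_sepClosed.of_normalForms`
(`Kuhlmann2019DegreePStepAssembly.lean`), i.e. of F.-V. Kuhlmann, *Elimination of ramification
II: Henselian rationality*, Israel J. Math. 234 (2019) = arXiv:1701.05508, **Lemma 4.3**
(pp. 8–10 of the arXiv text) as used in the proof of Prop. 4.9:

> **Lemma 4.3.** Assume that `char K = 0` and that `K` is closed under `p`-th roots. Then for
> every `f(x) ∈ K[x]` with `vf(x) > 0` there exists a polynomial `g(z) ∈ (1+f(x))·(K(x)^h)^p`
> [i.e. `1 + g(z) ∈ (1+f(x))·(K(x)^h)^p`] satisfying (4.14): `g(z) = a_nz^n + … + a_1z + a_0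
> ∈ 𝓜_K[z]` where `z = (x − c)/d`, with `vz = 0`, `c ∈ K` and `0 ≠ d ∈ K`, … and there is
> `i₀ ∈ {1,…,n}` with `p ∤ i₀` such that `a_{i₀}` is the unique coefficient of least value
> among `a_1,…,a_n`.
> *Proof.* … since the approximation type of `x` over `K` is transcendental, we may choose
> `α₀ ∈ v(x−K)` such that for all `c ∈ K` with `v(x−c) ≥ α₀` the values of `f_i(c)` are fixed,
> for every `i` … the values of all monomials `f_i(c)(x − c)^i` will be distinct and there is
> `i₀ ≥ 1` such that `vf_{i₀}(c)(x − c)^{i₀} < vf_i(c)(x − c)^i` for all `i ≥ 1`, `i ≠ i₀`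
> (cf. [23, Lemma 5.1 and Lemma 5.2]). … `0 < vf(x) = vf(c) < vf_i(c)(x − c)^i` for
> `1 ≤ i ≤ n`. … (4.15) if `j = p^t` and `i = p^tr` with `t ≥ 0` and `r > 1`, `(r,p) = 1`, then
> `vf_j(c)(x − c)^j < vf_i(c)(x − c)^i` … Fix any `c₁ ∈ K` with `v(x−c₁) ≥ α₀`. As
> `(K(x)|K, v)` is immediate, there is some `a ∈ K` with `v((x−c₁)/a) = 0`. We set
> `y = (x−c₁)/a` and `d_i = f_i(c₁)aⁱ`, so that `f(x) = ∑ d_iyⁱ` … [then (4.16), `g̃`] …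
> Now we distinguish two cases. Let us assume first that there is a monomial in the
> polynomial that has a value `≤ vp`. … By (4.15), the monomial `d_1y` is the unique one of
> minimal value in this sum. Hence `vd_1y ≤ vp`. … `d'_1y` is the unique summand of minimal
> value in `g̃(y)` … we arrive at a polynomial `g(z) = g̃(y)` and elements `c` and `d` which
> satisfy the assertion of our lemma in the first case. Now we consider the second case: all
> monomials in `g̃(y)` have value `> vp`.

This file PROVES, in the setting of Prop. 5.2 / `(H43)` (`K ≤ Ω` separably closed of
characteristic `0` — hence algebraically closed —, of rank one, `z` transcendental over `K`
with `(K(z)|K, v)` immediate, `char Ωv = p`), the reduction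
`normalForm43_or_caseTwo`: for `f` over `K` with `v(f(z)) < 1` and `1 + f(z)` not a `p`-th
power in `K(z)^h`, EITHER the conclusion of `(H43)` holds (first case), OR there are `c ∈ K`,
`0 ≠ d ∈ K` with `v(y) = 1`, `y = (z − c)/d`, and `g̃` over `K` with ALL coefficients of value
`< v(p)` and `1 + f(z) ∈ (1 + g̃(y))·(K(z)^h)^{×p}` (the data of the second case, treated in
`Kuhlmann2019Lemma43CaseTwo.lean`). The Kaplansky centre `c = c₁` is supplied by
`EventualDominance.lean` ([23, §§5–7] for the transcendental approximation type given by
Knaf–Kuhlmann 2009, Lemma 2.16, `kaplansky_condition_of_isSepClosed`; (4.15) for `t = 0` is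
`approach_linear_term_dominant`), the polynomial `g̃` by
`exists_radicand_without_pth_power_monomials` (`KummerPthPowerElimination.lean`).

## Sources

* [K19] F.-V. Kuhlmann, Israel J. Math. 234 (2019) = arXiv:1701.05508: Lemma 4.3, proof of
  Prop. 4.9. [Kuhlmann2019]
* [23] F.-V. Kuhlmann, I. Vlahu, Math. Z. 276 (2014) = arXiv:1304.0200: §§5–7.
* [KK09] H. Knaf, F.-V. Kuhlmann, Adv. Math. 221 (2009): Lemma 2.16. [KnafKuhlmann2009]

## Rendering notes

As in `Kuhlmann2019DegreePStepAssembly.lean` (whose hypothesis `(H43)` fixes the target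
statement): `(Ω, V)` algebraically closed valued field, `char Ω = 0`, `char Ωv = p`,
`K(z) = Subfield.closure (K ∪ {z})`, `K(z)^h = henselization V K(z)`, polynomials over `Ω` with
coefficients in `K`, "`a ∈ a'·(F^×)^p`" = `∃ w ∈ F, w ≠ 0 ∧ a = a'·w^p`, values
multiplicative.
-/

noncomputable section

open IsLocalRing Polynomial Finset

namespace Literature.AlgebraicGeometry.Resolution

universe u

variable {Ω : Type u} [Field Ω] (V : ValuationSubring Ω)

/-! ### Bookkeeping -/

/-- `K((z − c)/d) = K(z)` for `c ∈ K`, `d ∈ K^×`. [folklore] -/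
theorem closure_insert_sub_div_eq (K : Subfield Ω) {c d : Ω} (hcK : c ∈ K) (hdK : d ∈ K)
    (hd0 : d ≠ 0) (z : Ω) :
    Subfield.closure ((K : Set Ω) ∪ {(z - c) / d}) = Subfield.closure ((K : Set Ω) ∪ {z}) := by
  apply le_antisymm
  · rw [Subfield.closure_le]
    rintro w (hw | hw)
    · exact Subfield.subset_closure (Or.inl hw)
    · rw [Set.mem_singleton_iff] at hw
      subst hw
      exact div_mem (sub_mem (Subfield.subset_closure (Or.inr rfl))
        (Subfield.subset_closure (Or.inl hcK))) (Subfield.subset_closure (Or.inl hdK))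
  · rw [Subfield.closure_le]
    rintro w (hw | hw)
    · exact Subfield.subset_closure (Or.inl hw)
    · rw [Set.mem_singleton_iff] at hw
      subst hw
      have hmem : d * ((w - c) / d) + c ∈ Subfield.closure ((K : Set Ω) ∪ {(w - c) / d}) :=
        add_mem (mul_mem (Subfield.subset_closure (Or.inl hdK))
          (Subfield.subset_closure (Or.inr rfl))) (Subfield.subset_closure (Or.inl hcK))
      rwa [mul_div_cancel₀ _ hd0, sub_add_cancel] at hmem

/-- `(z − c)/d` is transcendental over `K` when `z` is (`c ∈ K`, `d ∈ K^×`). [folklore] -/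
theorem transcendental_sub_div (K : Subfield Ω) {c d : Ω} (hcK : c ∈ K) (hdK : d ∈ K) (hd0 : d ≠ 0)
    {z : Ω} (hz : Transcendental K z) : Transcendental K ((z - c) / d) := by
  intro halg
  apply hz
  have h1 : IsAlgebraic K (d * ((z - c) / d) + c) :=
    ((isAlgebraic_algebraMap (⟨d, hdK⟩ : K)).mul halg).add (isAlgebraic_algebraMap (⟨c, hcK⟩ : K))
  rwa [mul_div_cancel₀ _ hd0, sub_add_cancel] at h1

/-- A separably closed subfield of a field of characteristic `0` is algebraically closed.
[folklore] -/
theorem isAlgClosed_of_isSepClosed_of_charZero [CharZero Ω] (K : Subfield Ω) [IsSepClosed K] :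
    IsAlgClosed K := by
  haveI : CharZero K := K.subtype.charZero
  infer_instance

/-- The constant `C ∈ K` with `C^{p-1} = −p` in an algebraically closed `K`. [folklore] -/
theorem exists_C_pow_pred_eq (K : Subfield Ω) (hK : IsAlgClosed K) {p : ℕ} (hp : p.Prime) :
    ∃ C : Ω, C ∈ K ∧ C ^ (p - 1) = -(p : Ω) := by
  obtain ⟨C, hC⟩ := IsAlgClosed.exists_pow_nat_eq (-(p : K)) (Nat.sub_pos_of_lt hp.one_lt)
  refine ⟨C, C.2, ?_⟩
  have := congrArg Subtype.val hC
  simpa using this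

/-! ### The setting of `(H43)` -/

section Setting

variable [IsAlgClosed Ω] {p : ℕ} [hp : Fact p.Prime] [CharZero Ω] [CharP (ResidueField V) p]
  (K : Subfield Ω) [IsSepClosed K] (hr : IsRankOne V K)
include hr

/-- **`(H43)` for a radicand which is a `p`-th power** ("tiny `g`"): if `1 + f(z) = w₀^p` with
`w₀ ∈ K(z)^h` (and `v(f(z)) < 1`), then with `g = εY`, `0 < v(ε) < v(C)^p`, the radicand
`1 + g(y)` is a `p`-th power as well (Kuhlmann 2010, Lemma 2.10), so the conclusion of `(H43)`
holds with `c = 0`, `i₀ = 1`. [folklore] -/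
theorem normalForm43_of_pow_eq {z : Ω} (hz : Transcendental K z)
    (himm : IsImmediateOver V K (Subfield.closure ((K : Set Ω) ∪ {z})))
    {f : Polynomial Ω} (hfz : V.valuation (f.eval z) < 1)
    {w₀ : Ω} (hw₀ : w₀ ∈ henselization V (Subfield.closure ((K : Set Ω) ∪ {z})))
    (hfw₀ : w₀ ^ p = 1 + f.eval z) :
    ∃ c ∈ K, ∃ d ∈ K, d ≠ 0 ∧ V.valuation ((z - c) / d) = 1 ∧
      ∃ g : Polynomial Ω, (∀ k, g.coeff k ∈ K) ∧
        (∃ w ∈ henselization V (Subfield.closure ((K : Set Ω) ∪ {z})), w ≠ 0 ∧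
          1 + f.eval z = (1 + g.eval ((z - c) / d)) * w ^ p) ∧
        (∃ i₀, 0 < i₀ ∧ ¬ p ∣ i₀ ∧ g.coeff i₀ ≠ 0 ∧
          ∀ i, 0 < i → i ≠ i₀ → V.valuation (g.coeff i) < V.valuation (g.coeff i₀)) := by
  classical
  have hpr : p.Prime := hp.out
  set Kz : Subfield Ω := Subfield.closure ((K : Set Ω) ∪ {z}) with hKz
  set F : Subfield Ω := henselization V Kz with hFdef
  have hKKz : K ≤ Kz := fun c hc => Subfield.subset_closure (Or.inl hc)
  have hKF : K ≤ F := hKKz.trans (le_henselization V Kz)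
  have hzF : z ∈ F := le_henselization V Kz (Subfield.subset_closure (Or.inr rfl))
  have hF : IsHenselianField F (V.comap (algebraMap F Ω)) :=
    Kuhlmann2010HenselizationIsHenselian_holds Ω V Kz
  have hzK : z ∉ K := fun h => hz (isAlgebraic_algebraMap (⟨z, h⟩ : K))
  have hz0 : z ≠ 0 := fun h => hzK (h ▸ K.zero_mem)
  have hKalg : IsAlgClosed K := isAlgClosed_of_isSepClosed_of_charZero K
  obtain ⟨C, hCK, hC⟩ := exists_C_pow_pred_eq K hKalg hpr
  have hp0 : (p : Ω) ≠ 0 := Nat.cast_ne_zero.mpr hpr.ne_zero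
  have hvp : V.valuation (p : Ω) < 1 := valuation_natCast_lt_one_of_charP V p
  have hC0 : C ≠ 0 := C_ne_zero hpr hC hp0
  have hp1 : ¬ p ∣ 1 := fun h => hpr.ne_one (Nat.dvd_one.mp h)
  -- `d ∈ K` with `v(z) = v(d)`
  obtain ⟨d, hdK, hzd⟩ := himm.1 z (Subfield.subset_closure (Or.inr rfl)) hz0
  have hd0 : d ≠ 0 := fun h => by
    rw [h, map_zero] at hzd; exact hz0 ((_root_.map_eq_zero _).mp hzd)
  have hy : V.valuation ((z - 0) / d) = 1 := by
    rw [sub_zero, map_div₀, hzd, div_self ((_root_.map_ne_zero _).mpr hd0)]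
  set y : Ω := (z - 0) / d with hydef
  have hyF : y ∈ F := div_mem (sub_mem hzF (hKF K.zero_mem)) (hKF hdK)
  -- `ε = C^p a⁻¹` with `1 < v(a)`
  obtain ⟨⟨a, haK, ha1⟩, -⟩ := isRankOneValued_of_overrings V K hr.1 hr.2
  have ha0 : a ≠ 0 := fun h => by rw [h, map_zero] at ha1; exact not_lt_zero ha1
  set ε : Ω := C ^ p * a⁻¹ with hε
  have hεK : ε ∈ K := mul_mem (pow_mem hCK p) (inv_mem haK)
  have hε0 : ε ≠ 0 := mul_ne_zero (pow_ne_zero _ hC0) (inv_ne_zero ha0)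
  have hvε : V.valuation ε < V.valuation C ^ p := by
    rw [hε, map_mul, map_pow, map_inv₀]
    calc V.valuation C ^ p * (V.valuation a)⁻¹ < V.valuation C ^ p * 1 :=
          mul_lt_mul_of_pos_left (inv_lt_one_of_one_lt₀ ha1)
            (pow_pos ((Valuation.pos_iff _).mpr hC0) p)
      _ = V.valuation C ^ p := mul_one _
  -- `1 + ε y` is a `p`-th power in `F`
  have hεy : V.valuation (ε * y) < V.valuation C ^ p := by
    rw [map_mul, hy, mul_one]; exact hvε
  obtain ⟨w₁, hw₁F, hw₁⟩ := exists_pow_eq_one_add_of_valuation_lt V hF hpr (hKF hCK) hC hp0 hvp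
    (mul_mem (hKF hεK) hyF) hεy
  have hεy1 : V.valuation (ε * y) < V.valuation (1 : Ω) := by
    rw [map_one]; exact hεy.trans (valuation_C_pow_lt_one V hpr hC hvp)
  have hw₁0 : w₁ ≠ 0 := by
    rintro rfl
    rw [zero_pow hpr.ne_zero, eq_comm] at hw₁
    have : V.valuation (1 + ε * y) = 1 := by
      rw [Valuation.map_add_eq_of_lt_left _ hεy1, map_one]
    rw [hw₁, map_zero] at this
    exact zero_ne_one this
  have h1fz : (1 + f.eval z) ≠ 0 := by
    intro h0
    have : V.valuation (1 + f.eval z) = 1 := by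
      rw [Valuation.map_add_eq_of_lt_left _ (by rwa [map_one]), map_one]
    rw [h0, map_zero] at this
    exact zero_ne_one this
  have hw₀0 : w₀ ≠ 0 := by
    rintro rfl
    rw [zero_pow hpr.ne_zero] at hfw₀
    exact h1fz hfw₀.symm
  refine ⟨0, K.zero_mem, d, hdK, hd0, hy, Polynomial.C ε * X ^ 1, forall_coeff_C_mul_X_pow_mem hεK 1,
    ⟨w₀ / w₁, div_mem hw₀ hw₁F, div_ne_zero hw₀0 hw₁0, ?_⟩, ⟨1, Nat.one_pos, hp1, ?_, ?_⟩⟩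
  · have hev : (Polynomial.C ε * X ^ 1).eval ((z - 0) / d) = ε * y := by
      rw [hydef]; simp
    rw [hev, ← hw₁, ← hfw₀, div_pow, mul_comm, div_mul_cancel₀ _ (pow_ne_zero _ hw₁0)]
  · rw [coeff_C_mul_X_pow, if_pos rfl]; exact hε0
  · intro i _ hi1
    rw [coeff_C_mul_X_pow, if_neg hi1, coeff_C_mul_X_pow, if_pos rfl, map_zero]
    exact (Valuation.pos_iff _).mpr hε0

/-- **Kuhlmann 2019, Lemma 4.3 — the Kaplansky centre, the polynomial `g̃`, and the first
case.** Setting of `(H43)` (module docstring); `f` over `K` with `v(f(z)) < 1` and `1 + f(z)`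
not a `p`-th power in `K(z)^h`. Then EITHER the conclusion of `(H43)` holds, OR (second case)
there are `c ∈ K`, `0 ≠ d ∈ K` with `v((z−c)/d) = 1` and `g̃` over `K` all of whose
coefficients have value `< v(p)`, with `1 + f(z) ∈ (1 + g̃((z−c)/d))·(K(z)^h)^{×p}`. PROOF as
printed: `f` is non-constant (else `1 + f(z) ∈ K = K^p`); for `c ↗ z` (`EventualDominance.lean`)
all Taylor terms `d_i = f_i(c)dⁱ`, `i ≥ 1`, have value `≤ v(f(z) − f(c)) < v(f(z)) < 1`,
`v(d_0) = v(f(c)) = v(f(z)) < 1`, `d_1 ≠ 0` and `v(d_j) < v(d_1)` for `j ≥ 2` prime to `p`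
((4.15), `approach_linear_term_dominant`); `exists_radicand_without_pth_power_monomials` gives
`g̃`; if `v(d_1) ≥ v(p)` [multiplicatively `v(p) ≤ v(d_1)`] its first-case clause yields
`(H43)` with `i₀ = 1`, otherwise all `v(d_i) < v(p)` (`p ∤ i ≥ 1`) and its second-case clause
applies. [cite: Kuhlmann2019, Lemma 4.3] -/
theorem normalForm43_or_caseTwo {z : Ω} (hz : Transcendental K z)
    (himm : IsImmediateOver V K (Subfield.closure ((K : Set Ω) ∪ {z})))
    {f : Polynomial Ω} (hf : ∀ k, f.coeff k ∈ K) (hfz : V.valuation (f.eval z) < 1)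
    (hnt : ¬ ∃ w₀ ∈ henselization V (Subfield.closure ((K : Set Ω) ∪ {z})), w₀ ^ p = 1 + f.eval z) :
    (∃ c ∈ K, ∃ d ∈ K, d ≠ 0 ∧ V.valuation ((z - c) / d) = 1 ∧
      ∃ g : Polynomial Ω, (∀ k, g.coeff k ∈ K) ∧
        (∃ w ∈ henselization V (Subfield.closure ((K : Set Ω) ∪ {z})), w ≠ 0 ∧
          1 + f.eval z = (1 + g.eval ((z - c) / d)) * w ^ p) ∧
        (∃ i₀, 0 < i₀ ∧ ¬ p ∣ i₀ ∧ g.coeff i₀ ≠ 0 ∧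
          ∀ i, 0 < i → i ≠ i₀ → V.valuation (g.coeff i) < V.valuation (g.coeff i₀))) ∨
    (∃ c ∈ K, ∃ d ∈ K, d ≠ 0 ∧ V.valuation ((z - c) / d) = 1 ∧
      ∃ g : Polynomial Ω, (∀ k, g.coeff k ∈ K) ∧ (∀ k, V.valuation (g.coeff k) < V.valuation (p : Ω)) ∧
        ∃ w ∈ henselization V (Subfield.closure ((K : Set Ω) ∪ {z})), w ≠ 0 ∧
          1 + f.eval z = (1 + g.eval ((z - c) / d)) * w ^ p) := by
  classical
  have hpr : p.Prime := hp.out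
  set Kz : Subfield Ω := Subfield.closure ((K : Set Ω) ∪ {z}) with hKz
  set F : Subfield Ω := henselization V Kz with hFdef
  have hKKz : K ≤ Kz := fun c hc => Subfield.subset_closure (Or.inl hc)
  have hKF : K ≤ F := hKKz.trans (le_henselization V Kz)
  have hzKz : z ∈ Kz := Subfield.subset_closure (Or.inr rfl)
  have hzF : z ∈ F := le_henselization V Kz hzKz
  have hF : IsHenselianField F (V.comap (algebraMap F Ω)) :=
    Kuhlmann2010HenselizationIsHenselian_holds Ω V Kz
  have hKalg : IsAlgClosed K := isAlgClosed_of_isSepClosed_of_charZero K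
  obtain ⟨C, hCK, hC⟩ := exists_C_pow_pred_eq K hKalg hpr
  have hp0 : (p : Ω) ≠ 0 := Nat.cast_ne_zero.mpr hpr.ne_zero
  have hvp : V.valuation (p : Ω) < 1 := valuation_natCast_lt_one_of_charP V p
  have hvp0 : 0 < V.valuation (p : Ω) := (Valuation.pos_iff _).mpr hp0
  have hp1 : ¬ p ∣ 1 := fun h => hpr.ne_one (Nat.dvd_one.mp h)
  have hr1 : IsRankOneValued V K := isRankOneValued_of_overrings V K hr.1 hr.2
  -- transcendence in polynomial form, `z ∉ K`, immediateness as `hval`, `hres`, and `h3`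
  have htrans : ∀ P : Polynomial Ω, (∀ k, P.coeff k ∈ K) → P.eval z = 0 → P = 0 := by
    intro P hP hPz
    obtain ⟨P', hP'⟩ : ∃ P' : Polynomial K, P'.map (algebraMap K Ω) = P :=
      (Polynomial.mem_lifts P).mp ((Polynomial.lifts_iff_coeff_lifts P).mpr
        fun k => ⟨⟨P.coeff k, hP k⟩, rfl⟩)
    by_contra hP0
    refine hz ⟨P', fun h => hP0 ?_, ?_⟩
    · rw [← hP', h, Polynomial.map_zero]
    · rw [Polynomial.aeval_def, ← Polynomial.eval_map, hP', hPz]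
  have hzK : z ∉ K := not_mem_of_forall_eval_eq_zero K htrans
  have hval : ∀ w ∈ Kz, w ≠ 0 → ∃ b ∈ K, V.valuation w = V.valuation b := himm.1
  have hres : ∀ w ∈ Kz, w ∈ V → ∃ c ∈ K, V.valuation (w - c) < 1 := by
    intro w hw hwV
    have hrw : residue V ⟨w, hwV⟩ ∈ resField V K := himm.2 (residue_mem_resField V ⟨w, hwV⟩ hw)
    obtain ⟨c, hcK, hcw⟩ := (mem_resField_iff V K _).mp hrw
    refine ⟨c, hcK, ?_⟩
    have h0 : residue V (⟨w, hwV⟩ - c) = 0 := by rw [map_sub, hcw, sub_self]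
    exact (ValuationSubring.valuation_lt_one_iff V (⟨w, hwV⟩ - c)).mp ((residue_eq_zero_iff _).mp h0)
  have h3 := kaplansky_condition_of_isSepClosed V K htrans hval hres
  /- `f` is non-constant -/
  have hfz0 : f.eval z ≠ 0 := by
    intro h0
    have hf0 : f = 0 := htrans f hf h0
    refine hnt ⟨1, F.one_mem, ?_⟩
    rw [h0, add_zero, one_pow]
  have hN : 0 < f.natDegree := by
    by_contra hN
    push Not at hN
    obtain ⟨f₀, hf₀⟩ := natDegree_eq_zero.mp (Nat.le_zero.mp hN)
    -- `1 + f₀ ∈ K` is a `p`-th power in `K`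
    have hf₀K : f₀ ∈ K := by have := hf 0; rwa [← hf₀, coeff_C_zero] at this
    obtain ⟨r, hr'⟩ := IsAlgClosed.exists_pow_nat_eq (⟨1 + f₀, add_mem K.one_mem hf₀K⟩ : K) hpr.pos
    refine hnt ⟨r, hKF r.2, ?_⟩
    have := congrArg Subtype.val hr'
    push_cast at this
    rw [this, ← hf₀, eval_C]
  have hf' : hasseDeriv 1 f ≠ 0 := by
    intro h0
    rw [hasseDeriv_one'] at h0
    have := derivative_eq_zero.mp h0
    omega
  /- the Kaplansky centre `c`: thresholds from `EventualDominance.lean` -/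
  obtain ⟨T₁, hT₁K, hT₁⟩ := approach_valuation_sub_eval_lt V K hzK hval hres h3 hf hfz0
  obtain ⟨α, h, hh, hhN, hαh, T₂, hT₂K, hT₂⟩ :=
    exists_eventually_dominant_taylor_term V K hzK hval hres h3 hf hN
  obtain ⟨T₃, hT₃K, hT₃⟩ := approach_linear_term_dominant V K htrans hval hres h3 hf hf'
  obtain ⟨T₁₂, hT₁₂K, hT₁₂⟩ := approach_eventually_and V K ⟨T₁, hT₁K, hT₁⟩ ⟨T₂, hT₂K, hT₂⟩
  obtain ⟨c, hcK, hc⟩ := approach_eventually_and V K ⟨T₁₂, hT₁₂K, hT₁₂⟩ ⟨T₃, hT₃K, hT₃⟩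
  obtain ⟨⟨hlt, hcoef, hdom⟩, hlin0, hlin⟩ := hc c hcK le_rfl
  -- `d ∈ K` with `v(d) = v(z - c)`, `y = (z - c)/d`
  have hzc0 : z - c ≠ 0 := sub_ne_zero.mpr fun h => hzK (h ▸ hcK)
  obtain ⟨d, hdK, hzd⟩ := hval (z - c) (sub_mem hzKz (hKKz hcK)) hzc0
  have hd0 : d ≠ 0 := fun h => by
    rw [h, map_zero] at hzd; exact hzc0 ((_root_.map_eq_zero _).mp hzd)
  have hvd0 : V.valuation d ≠ 0 := (_root_.map_ne_zero _).mpr hd0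
  set y : Ω := (z - c) / d with hydef
  have hy : V.valuation y = 1 := by rw [hydef, map_div₀, hzd, div_self hvd0]
  have hyF : y ∈ F := div_mem (sub_mem hzF (hKF hcK)) (hKF hdK)
  have hdy : d * y = z - c := by rw [hydef, mul_div_cancel₀ _ hd0]
  /- the polynomial `P = ∑ d_i Y^i`, `d_i = f_i(c) d^i` -/
  set N := f.natDegree with hNdef
  set P : Polynomial Ω := ∑ i ∈ range (N + 1), Polynomial.C ((taylor c f).coeff i * d ^ i) * X ^ i
    with hP
  have hPcoeff : ∀ n, P.coeff n = if n < N + 1 then (taylor c f).coeff n * d ^ n else 0 := by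
    intro n
    rw [hP, finsetSum_coeff]
    simp only [coeff_C_mul_X_pow]
    rw [sum_ite_eq (range (N + 1)) n]
    by_cases hlt' : n < N + 1
    · rw [if_pos (mem_range.mpr hlt'), if_pos hlt']
    · rw [if_neg (fun h' => hlt' (mem_range.mp h')), if_neg hlt']
  have hPcoeff' : ∀ n, P.coeff n = (taylor c f).coeff n * d ^ n := by
    intro n
    rw [hPcoeff]
    split_ifs with h
    · rfl
    · rw [coeff_eq_zero_of_natDegree_lt (p := taylor c f) (by rw [natDegree_taylor]; omega),
        zero_mul]
  have hPK : ∀ n, P.coeff n ∈ K := fun n => by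
    rw [hPcoeff']; exact mul_mem (coeff_taylor_mem K hf hcK n) (pow_mem hdK n)
  have hPy : P.eval y = f.eval z := by
    have h1 : f.eval z = (taylor c f).eval (z - c) := by rw [taylor_eval, sub_add_cancel]
    rw [h1, eval_eq_sum_range' (p := taylor c f) (n := N + 1)
      (by rw [natDegree_taylor]; exact Nat.lt_succ_self _), hP, eval_finsetSum]
    refine sum_congr rfl fun i _ => ?_
    simp only [eval_mul, eval_C, eval_pow, eval_X]
    rw [mul_assoc, ← mul_pow, hdy]
  -- values of the coefficients of `P`
  have hvfc : V.valuation (f.eval c) = V.valuation (f.eval z) := by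
    have : f.eval c = f.eval z - (f.eval z - f.eval c) := by ring
    rw [this]; exact Valuation.map_sub_eq_of_lt_left _ hlt
  have hterm : ∀ i, 1 ≤ i → i ≤ N → V.valuation ((taylor c f).coeff i * d ^ i) ≤
      V.valuation (f.eval z - f.eval c) := by
    intro i hi hiN
    rw [valuation_sub_eval_eq_of_dominant V hh hhN hcoef hdom hαh hzc0, map_mul, map_pow, ← hzd,
      hcoef i hi hiN]
    by_cases hih : i = h
    · rw [hih]
    · exact (hdom i hi hiN hih).le
  have hPv : ∀ n, V.valuation (P.coeff n) < 1 := by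
    intro n
    rw [hPcoeff']
    rcases Nat.eq_zero_or_pos n with rfl | hn
    · rw [pow_zero, mul_one, taylor_coeff_zero, hvfc]; exact hfz
    · by_cases hnN : n ≤ N
      · exact ((hterm n hn hnN).trans_lt hlt).trans hfz
      · rw [coeff_eq_zero_of_natDegree_lt (p := taylor c f) (by rw [natDegree_taylor]; omega),
          zero_mul, map_zero]; exact zero_lt_one
  have hP1 : V.valuation (P.coeff 1) ≠ 0 := by
    rw [hPcoeff', map_mul, pow_one]; exact mul_ne_zero hlin0 hvd0
  have hP10 : 0 < V.valuation (P.coeff 1) := zero_lt_iff.mpr hP1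
  have hPdom : ∀ j, 2 ≤ j → ¬ p ∣ j → V.valuation (P.coeff j) < V.valuation (P.coeff 1) := by
    intro j hj hpj
    rw [hPcoeff', hPcoeff', map_mul, map_mul, map_pow, pow_one, ← hzd]
    refine hlin j hj (valuation_natCast_eq_one_of_residue_ne_zero V ?_)
    rwa [Ne, CharP.cast_eq_zero_iff (ResidueField V) p]
  /- the polynomial `g̃` -/
  obtain ⟨g, hgK, hgv, ⟨w, hwF, hw0, hw⟩, hcase1, hcase2⟩ :=
    exists_radicand_without_pth_power_monomials V hKalg hr1 hKF hF hCK hC hp0 hvp hyF hy.le hPK hPv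
  rw [hPy] at hw
  by_cases h1 : V.valuation (p : Ω) ≤ V.valuation (P.coeff 1)
  · -- first case
    left
    obtain ⟨hg1, hgm⟩ := hcase1 h1 hPdom
    refine ⟨c, hcK, d, hdK, hd0, hy, g, hgK, ⟨w, hwF, hw0, hw⟩, 1, Nat.one_pos, hp1, ?_, ?_⟩
    · intro h0; rw [h0, map_zero] at hg1; exact hP1 hg1.symm
    · intro i hi hi1
      rw [hg1]; exact hgm i (by omega)
  · -- second case
    right
    push Not at h1
    have h2 : ∀ i, 1 ≤ i → ¬ p ∣ i → V.valuation (P.coeff i) < V.valuation (p : Ω) := by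
      intro i hi hpi
      rcases Nat.lt_or_ge i 2 with hlt2 | hge2
      · obtain rfl : i = 1 := by omega
        exact h1
      · exact (hPdom i hge2 hpi).trans h1
    exact ⟨c, hcK, d, hdK, hd0, hy, g, hgK, hcase2 h2, w, hwF, hw0, hw⟩

end Setting

end Literature.AlgebraicGeometry.Resolution

end
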